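import Summits.ABC.IUTFork.Joshi.InitialThetaDataJoshiQRootProofs
import Literature.IUT.HodgeTheaters.InitialThetaDataSplitBaseProofs
import Mathlib.Analysis.SpecificLimits.Normed
import HarnessLib

/-!
# [J-III] §3.4.1 «the Tate parameter of `C/L_v` has a `2ℓ`th-root in `L'_w`» — the typed ι-form
# `TateParameterRootTwoL` DISCHARGED, and the split gloss of §3.2 (6) is AUTOMATIC under (10)

Proof-only companion (theorems only; no definition, no named fact, no instance) of
`Summits/ABC/IUTFork/Joshi/InitialThetaDataJoshi.lean` (abc-iut-E-t6, p428841) and of its sequels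
`InitialThetaDataJoshiProofs.lean` (p430563) / `InitialThetaDataJoshiQRootProofs.lean` (p430839); cell abc-iut,
block E «type Joshi's construction, test vs S» (rung LADDER-ABC:A2.E), seat abc-iut-E-t63 (DERIVABLE discharge in
E-t6's cluster, slot-book rule 07:46:39Z). TAKES NO SIDE on [IUTchIII] Cor. 3.12, on the claims of K. Joshi, or on
S. Mochizuki's reports on them; typed ≠ proved — except that the rows below ARE now kernel theorems about Joshi's
typed data `D : ATS3.InitialThetaData L L' Lbar C ℓ` ((1)–(14) of [J-III] §3.1/§3.3; [J-III] = K. Joshi,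
*Construction of Arithmetic Teichmüller Spaces III*, arXiv:2401.13508v4, «Preliminary version for comments»,
UNREFEREED; render `HOME/lit/renders/Joshi-arxiv-2401.13508/pNNNN.txt`, «p.N l.M» = line M of page file N):

* `tateParameterRootTwoL_holds : D.TateParameterRootTwoL` — **[J-III] §3.4.1, p.29 l.17–19** «In particular, if
  `w | v` for a prime `v | p` of `L`, then the Tate parameter of `C/L_v` has an `2ℓ`th-root in `L'_w`», in the
  typed ι-FORM of the statement file (the tree's `tateParameter (C ⊗ L_v) hj ∈ L_v` pushed along a posited
  continuous `L`-compatible `ι : L_v →+* L'_w`). E-t6's `exists_root_tateParameter_of_split` (p430839) gave a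
  `2ℓ`-th root of the Tate parameter READ IN `L'_w` under a hypothesis `hsplit`; this file removes both residues:
  (a) **`hsplit` is automatic**: multiplicative reduction + more than `n` rational points of ODD order `n` force
  SPLIT multiplicative reduction (Silverman ATAEC Thm. V.5.3 / Cor. V.5.4; the tree's
  `Literature.IUT.HodgeTheaters.hasSplitMultiplicativeReductionAt_of_hasMultiplicativeReductionAt_of_rational_odd_torsion`,
  abc-iut-L5-t12, over `Literature.NumberTheory.EllipticCurves.TateCurve.hasSplitMultiplicativeReductionAt_of_odd_torsion`),
  fed with the `ℓ²` `L'`-rational `ℓ`-torsion points of (12)–(13) (`exists_finset_l_torsion`, `ℓ ≥ 5` odd) over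
  `L'`, resp. the nine `L`-rational `3`-torsion points of (10) over `L` (`exists_finset_three_torsion`);
  (b) **transport** `ι (tateJ q) = tateJ (ι q)` of the Tate series along a continuous ring homomorphism out of a
  complete ultrametric field (`TateTransport.map_tateE4/map_tateDelta/map_tateJ`: Mathlib's `Summable.map_tsum` /
  `Multipliable.map_tprod` on the tree's `summable_tateE4_term` / `multipliable_tateDelta_factor`), `‖ι q‖ < 1`
  (`TateTransport.norm_map_lt_one`), and uniqueness of the Tate parameter on the punctured unit disc (the tree's
  `eq_of_tateJ_eq`, ATAEC Lemma V.5.1) ⟹ `ι(q_v) = q_w`, whence `q_v` acquires the root of `q_w`.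
* `voddssMod_eq_voddSplitMod : VoddssMod C = VoddSplitMod C` (given `D`) — the statement file's READING FLAG on
  **§3.2 (6), p.27 l.23–25** «bad, semi-stable reduction i.e. split multiplicative reduction» DISSOLVES in kernel:
  under (10) («`L(C[6](L̄)) = L`») the multiplicative reading `VoddssMod` and the author's split gloss `VoddSplitMod`
  COINCIDE (nine `L`-rational points of order dividing `3` at every multiplicative place). Likewise over `L'`:
  `hasSplitMultiplicativeReductionAt_baseChange_of_hasMultiplicativeReductionAt` (every multiplicative place of
  `C ×_L L'` is split) and `exists_pow_two_mul_l_eq_tateParameter_of_mem_voddss` (E-t6's theorem, `hsplit` gone).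

Universe note: the tree's number-field Tate-curve and torsion-cardinality files are typed over fields in `Type`, so —
as in E-t6's proofs files — `L L' Lbar : Type` here. Inputs: Mathlib and LANDED tree theorems only, imported BY NAME (DEFS-FREEZE
respected; nothing of `InitialThetaDataJoshi.lean` restated); no new `Prop` fact, no `sorry`.
[claim: Joshi2024ATS3, status: disputed]

## References
* [Joshi2024ATS3] K. Joshi, arXiv:2401.13508v4, §3.2 (6) p.27 l.23–25, §3.3 (10) p.28 l.4, §3.4.1 p.29 l.9–19.
* [SilvermanATAEC1994] J. H. Silverman, *Advanced Topics in the Arithmetic of Elliptic Curves*, GTM 151, Springer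
  1994, Thm. V.3.1 (b) (the series `E₄(q)`, `Δ(q)`, `j(q)`), Lemma V.5.1 (uniqueness of `q`), Thm. V.5.3 and
  Cor. V.5.4 (PDF pp. 405–410).
-/

noncomputable section

open scoped Classical
open NumberField IsDedekindDomain WeierstrassCurve Filter Topology
open Literature.IUT.HodgeTheaters hiding InitialThetaData

universe u v

/-! ## §1 Transport of the Tate series `E₄(q)`, `Δ(q)`, `j(q)` along a continuous ring homomorphism -/

namespace Summit.ABC.IUTFork.Joshi.ATS3.TateTransport

open Literature.NumberTheory.EllipticCurves
open scoped ArithmeticFunction.sigma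

variable {K₁ : Type u} {K₂ : Type v} [NormedField K₁] [IsUltrametricDist K₁] [CompleteSpace K₁]
  [NormedField K₂] (ι : K₁ →+* K₂) (hι : Continuous ι)

include hι

/-- **`ι(E₄(q)) = E₄(ι q)`** for `‖q‖ < 1` and a continuous ring homomorphism `ι` out of a complete ultrametric
normed field: the Eisenstein series `E₄(q) = 1 + 240 ∑ σ₃(n) qⁿ` (Silverman ATAEC V.3.1 (b); the tree's `tateE4`,
summable by `summable_tateE4_term`) is mapped termwise (Mathlib `Summable.map_tsum`).
[cite: SilvermanATAEC1994, Thm. V.3.1 (b) (PDF p. 395)] -/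
theorem map_tateE4 {q : K₁} (hq : ‖q‖ < 1) : ι (tateE4 q) = tateE4 (ι q) := by
  have hs := (summable_tateE4_term hq).map_tsum (γ := K₂) ι hι
  unfold tateE4
  rw [map_add, map_one, map_mul, map_ofNat, hs]
  congr 2
  refine tsum_congr fun n => ?_
  simp only [map_mul, map_natCast, map_pow]

/-- **`ι(Δ(q)) = Δ(ι q)`** for `‖q‖ < 1`: the discriminant `Δ(q) = q ∏ (1 − qⁿ)²⁴` (Silverman ATAEC V.3.1 (b);
the tree's `tateDelta`, multipliable by `multipliable_tateDelta_factor`) is mapped factorwise (Mathlib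
`Multipliable.map_tprod`). [cite: SilvermanATAEC1994, Thm. V.3.1 (b) (PDF p. 395)] -/
theorem map_tateDelta {q : K₁} (hq : ‖q‖ < 1) : ι (tateDelta q) = tateDelta (ι q) := by
  have hp := (multipliable_tateDelta_factor hq).map_tprod (γ := K₂) ι hι
  unfold tateDelta
  rw [map_mul, hp]
  congr 1
  refine tprod_congr fun n => ?_
  simp only [map_pow, map_sub, map_one]

/-- **`ι(j(q)) = j(ι q)`** for `‖q‖ < 1`: the `j`-invariant of the Tate curve `j(q) = E₄(q)³/Δ(q)` (the tree's
`tateJ`) commutes with continuous ring homomorphisms out of a complete ultrametric field.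
[cite: SilvermanATAEC1994, Thm. V.3.1 (b) (PDF p. 395)] -/
theorem map_tateJ {q : K₁} (hq : ‖q‖ < 1) : ι (tateJ q) = tateJ (ι q) := by
  unfold tateJ
  rw [map_div₀, map_pow, map_tateE4 ι hι hq, map_tateDelta ι hι hq]

omit [IsUltrametricDist K₁] [CompleteSpace K₁] in
/-- A continuous ring homomorphism of normed fields maps the open unit disc into the open unit disc:
`‖q‖ < 1 ⟹ ‖ι q‖ < 1` (`qⁿ → 0`, hence `(ι q)ⁿ = ι(qⁿ) → 0`, hence `‖ι q‖ⁿ → 0`). [folklore] -/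
theorem norm_map_lt_one {q : K₁} (hq : ‖q‖ < 1) : ‖ι q‖ < 1 := by
  have h1 : Tendsto (fun n : ℕ => q ^ n) atTop (𝓝 0) := tendsto_pow_atTop_nhds_zero_of_norm_lt_one hq
  have h2 : Tendsto (fun n : ℕ => ‖ι q‖ ^ n) atTop (𝓝 0) := by
    have h := ((hι.tendsto 0).comp h1).norm
    rw [map_zero, norm_zero] at h
    refine h.congr fun n => ?_
    simp only [Function.comp_apply, map_pow, norm_pow]
  have h3 := tendsto_pow_atTop_nhds_zero_iff.mp h2
  rwa [abs_of_nonneg (norm_nonneg _)] at h3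

end Summit.ABC.IUTFork.Joshi.ATS3.TateTransport

/-! ## §2 For Joshi's data: multiplicative places are SPLIT multiplicative ((10), resp. (12)–(13)) -/

namespace Summit.ABC.IUTFork.Joshi.ATS3.InitialThetaData

open Literature.NumberTheory.EllipticCurves Literature.NumberTheory.EllipticCurves.TateCurve

section Split

variable {L L' Lbar : Type} [Field L] [NumberField L] [Field L'] [NumberField L'] [Algebra L L'] [Field Lbar]
  [Algebra L Lbar] [Algebra L' Lbar] {C : WeierstrassCurve L} [C.IsElliptic] {ℓ : ℕ}

omit [NumberField L] [C.IsElliptic] in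
/-- Transport of a finset of points killed by `n` along an EQUALITY of Weierstrass curves (replay of the private
helper of the same name in E-t6's QRootProofs). [folklore] -/
private theorem exists_finset_torsion_of_eq {K : Type*} [Field K] {W₁ W₂ : WeierstrassCurve K} (h : W₁ = W₂)
    {n : ℕ} (S : Finset W₁.toAffine.Point) (hS : ∀ P ∈ S, n • P = 0) :
    ∃ S' : Finset W₂.toAffine.Point, S'.card = S.card ∧ ∀ P ∈ S', n • P = 0 := by
  subst h
  exact ⟨S, rfl, hS⟩

variable (D : InitialThetaData L L' Lbar C ℓ)

include D

/-- **`C(L)` has full `3`-torsion**: nine distinct `L`-points killed by `3` — `#C[3](L̄) = 3²` (Silverman AEC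
III.6.4 (b); the tree's `card_torsionPoints_eq_sq_holds` over the algebraically closed `L̄`) and every `L̄`-point
killed by `3` is killed by `6`, hence `L`-rational by **(10), p.28 l.4** «`L(C[6](L̄)) = L`»
(`torsion_six_rational`). Replay for Joshi's data of the tree's
`Literature.IUT.HodgeTheaters.InitialThetaData.exists_finset_three_torsion` (abc-iut-L5-t12).
[claim: Joshi2024ATS3, status: disputed] [cite: SilvermanAEC2009, Cor. III.6.4(b)] -/
theorem exists_finset_three_torsion :
    ∃ S : Finset (C.toAffine.baseChange L).Point, S.card = 9 ∧ ∀ P ∈ S, 3 • P = 0 := by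
  haveI := D.isAlgClosure
  haveI : IsAlgClosed Lbar := IsAlgClosure.isAlgClosed L
  haveI : CharZero Lbar := charZero_of_injective_algebraMap (algebraMap L Lbar).injective
  -- the geometric `3`-torsion: `9` points
  have h9 : Nat.card (torsionPoints C Lbar ((3 : ℕ) : ℤ)) = 3 ^ 2 :=
    card_torsionPoints_eq_sq_holds C Lbar (n := 3) (by norm_num)
  haveI : Finite (torsionPoints C Lbar ((3 : ℕ) : ℤ)) := Nat.finite_of_card_ne_zero (by rw [h9]; norm_num)
  haveI : Fintype (torsionPoints C Lbar ((3 : ℕ) : ℤ)) := Fintype.ofFinite _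
  let S₀ : Finset (C.baseChange Lbar).toAffine.Point :=
    Finset.univ.map ⟨((↑) : torsionPoints C Lbar ((3 : ℕ) : ℤ) → (C.baseChange Lbar).toAffine.Point),
      Subtype.val_injective⟩
  have hS₀card : S₀.card = 9 := by
    rw [Finset.card_map, Finset.card_univ, ← Nat.card_eq_fintype_card, h9]
    norm_num
  have hS₀mem : ∀ x ∈ S₀, (3 : ℤ) • x = 0 := by
    intro x hx
    obtain ⟨y, -, rfl⟩ := Finset.mem_map.mp hx
    exact (mem_torsionPoints_iff C Lbar (y : (C.baseChange Lbar).toAffine.Point)).mp y.2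
  -- every such point is `L`-rational ((10))
  have hrat : ∀ x ∈ S₀, ∃ P : (C.toAffine.baseChange L).Point,
      Affine.Point.baseChange (W' := C.toAffine) L Lbar P = x := by
    intro x hx
    have h6 : (6 : ℤ) • x = 0 := by
      rw [show (6 : ℤ) = 2 * 3 by norm_num, mul_zsmul, hS₀mem x hx, zsmul_zero]
    obtain ⟨P, hP⟩ := D.torsion_six_rational x h6
    exact ⟨P, hP⟩
  choose! f hf using hrat
  have hinj : Set.InjOn f S₀ := by
    intro x hx y hy h
    rw [← hf x hx, ← hf y hy, h]
  refine ⟨S₀.image f, ?_, ?_⟩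
  · rw [Finset.card_image_of_injOn hinj, hS₀card]
  · intro P hP
    obtain ⟨x, hx, rfl⟩ := Finset.mem_image.mp hP
    apply Affine.Point.map_injective (Algebra.ofId L Lbar)
    change Affine.Point.baseChange (W' := C.toAffine) L Lbar (3 • f x) =
      Affine.Point.baseChange (W' := C.toAffine) L Lbar 0
    rw [map_nsmul, map_zero, hf x hx, ← natCast_zsmul]
    exact hS₀mem x hx

/-- **Under (10), every multiplicative place of `C/L` is SPLIT multiplicative** (multiplicative reduction at `v`
and `9 > 3` rational points killed by the odd `3` exclude the non-split twist: Silverman ATAEC Thm. V.5.3 /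
Cor. V.5.4, the tree's `hasSplitMultiplicativeReductionAt_of_hasMultiplicativeReductionAt_of_rational_odd_torsion`).
[claim: Joshi2024ATS3, status: disputed] [cite: SilvermanATAEC1994, Thm. V.5.3 and Cor. V.5.4 (PDF pp. 407–410)] -/
theorem hasSplitMultiplicativeReductionAt_of_hasMultiplicativeReductionAt (v : HeightOneSpectrum (𝓞 L))
    (hmult : C.HasMultiplicativeReductionAt v) : C.HasSplitMultiplicativeReductionAt v := by
  obtain ⟨S, hS, hS3⟩ := D.exists_finset_three_torsion
  exact hasSplitMultiplicativeReductionAt_of_hasMultiplicativeReductionAt_of_rational_odd_torsion C v hmult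
    (by decide : Odd 3) S hS3 (by rw [hS]; norm_num)

/-- **[J-III] §3.2 (6), p.27 l.23–25 — the READING FLAG dissolves: `V^{odd,ss}_{L_mod}` (multiplicative reading,
`VoddssMod`) EQUALS the author's gloss «i.e. split multiplicative reduction» (`VoddSplitMod`)** for any data
satisfying (10): at a prime of `L_mod` over which every place of `L` is multiplicative, every such place is split
(`hasSplitMultiplicativeReductionAt_of_hasMultiplicativeReductionAt`); the other inclusion is the statement file's
`voddSplitMod_subset`. [claim: Joshi2024ATS3, status: disputed]
[cite: SilvermanATAEC1994, Thm. V.5.3 and Cor. V.5.4 (PDF pp. 407–410)] -/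
theorem voddssMod_eq_voddSplitMod : VoddssMod C = VoddSplitMod C :=
  Set.Subset.antisymm
    (fun _ hw => ⟨hw.1, fun v hv =>
      D.hasSplitMultiplicativeReductionAt_of_hasMultiplicativeReductionAt v.maximalIdeal (hw.2 v hv)⟩)
    (voddSplitMod_subset C)

/-- **Under (12)–(13), every multiplicative place of `C ×_L L'` is SPLIT multiplicative**: `C(L')` contains `ℓ²`
points killed by the odd prime `ℓ ≥ 5` (E-t6's `exists_finset_l_torsion`: the `𝔽_ℓ`-basis of `C[ℓ](L̄)` descended
to `L'` by (13)), and `ℓ² > ℓ` (Silverman ATAEC Thm. V.5.3 / Cor. V.5.4). In particular the hypothesis `hsplit` of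
E-t6's `exists_pow_two_mul_l_eq_tateParameter` holds at EVERY place of multiplicative reduction.
[claim: Joshi2024ATS3, status: disputed] [cite: SilvermanATAEC1994, Thm. V.5.3 and Cor. V.5.4 (PDF pp. 407–410)] -/
theorem hasSplitMultiplicativeReductionAt_baseChange_of_hasMultiplicativeReductionAt
    (w : HeightOneSpectrum (𝓞 L')) (hmult : (C.baseChange L').HasMultiplicativeReductionAt w) :
    (C.baseChange L').HasSplitMultiplicativeReductionAt w := by
  haveI := D.isScalarTower
  haveI : (C.baseChange L').IsElliptic := inferInstanceAs (C.map (algebraMap L L')).IsElliptic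
  obtain ⟨S, hS, hSl⟩ := D.exists_finset_l_torsion
  have hEq : C.toAffine.baseChange L' = (C.baseChange L').toAffine.baseChange L' := by
    show C.map (algebraMap L L') = (C.map (algebraMap L L')).map (algebraMap L' L')
    rw [WeierstrassCurve.map_map, Algebra.algebraMap_self, RingHom.id_comp]
  obtain ⟨S', hS', hS'l⟩ := exists_finset_torsion_of_eq hEq S hSl
  have h5 := D.five_le
  have hodd : Odd ℓ := D.prime.odd_of_ne_two (by omega)
  refine hasSplitMultiplicativeReductionAt_of_hasMultiplicativeReductionAt_of_rational_odd_torsion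
    (C.baseChange L') w hmult hodd S' hS'l ?_
  rw [hS', hS, sq]
  nlinarith

/-- The same at a place of Joshi's `V^{odd,ss}_{L'}` (`Voddss C L'`: odd residue characteristic and multiplicative
reduction of `C ×_L L'`, §3.2 (8) p.27 l.29): it is a place of SPLIT multiplicative reduction.
[claim: Joshi2024ATS3, status: disputed] [cite: SilvermanATAEC1994, Thm. V.5.3 and Cor. V.5.4 (PDF pp. 407–410)] -/
theorem hasSplitMultiplicativeReductionAt_of_mem_voddss (w₀ : FinitePlace L') (hw : w₀ ∈ ATS3.Voddss C L') :
    (C.baseChange L').HasSplitMultiplicativeReductionAt w₀.maximalIdeal :=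
  D.hasSplitMultiplicativeReductionAt_baseChange_of_hasMultiplicativeReductionAt w₀.maximalIdeal hw.2

/-- The same over `L` itself at a place of `V^{odd,ss}_L` (`Voddss C L`, phrased with `C ×_L L = C`).
[claim: Joshi2024ATS3, status: disputed] [cite: SilvermanATAEC1994, Thm. V.5.3 and Cor. V.5.4 (PDF pp. 407–410)] -/
theorem hasSplitMultiplicativeReductionAt_of_mem_voddss_base (v₀ : FinitePlace L) (hv : v₀ ∈ ATS3.Voddss C L) :
    C.HasSplitMultiplicativeReductionAt v₀.maximalIdeal := by
  have hC : C.baseChange L = C := by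
    show C.map (algebraMap L L) = C
    rw [Algebra.algebraMap_self, WeierstrassCurve.map_id]
  have hmult : C.HasMultiplicativeReductionAt v₀.maximalIdeal := by
    have h := hv.2
    rwa [hC] at h
  exact D.hasSplitMultiplicativeReductionAt_of_hasMultiplicativeReductionAt v₀.maximalIdeal hmult

/-! ## §3 The `2ℓ`-th root of the Tate parameter, `hsplit` discharged, and the ι-form -/

/-- **[J-III] §3.4.1 «the Tate parameter … has a `2ℓ`th-root in `L'_w`» at EVERY multiplicative place `w` of
`C ×_L L'`** — E-t6's `exists_pow_two_mul_l_eq_tateParameter` (p430839) with its hypothesis `hsplit` DISCHARGED by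
`hasSplitMultiplicativeReductionAt_baseChange_of_hasMultiplicativeReductionAt`: the Tate parameter `q_w ∈ L'_w`
(`q_w ≠ 0`, `‖q_w‖ < 1`, `tateJ q_w = j(C)`) is `r ^ (2ℓ)`, and `w(j(C)) = (w r)⁻¹ ^ (2ℓ)`.
[claim: Joshi2024ATS3, status: disputed] [cite: SilvermanATAEC1994, Thm. V.5.3 (PDF pp. 407–409)] -/
theorem exists_pow_two_mul_l_eq_tateParameter_of_hasMultiplicativeReductionAt (w : HeightOneSpectrum (𝓞 L'))
    (hmult : (C.baseChange L').HasMultiplicativeReductionAt w) :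
    ∃ q r : w.adicCompletion L', q ≠ 0 ∧ ‖q‖ < 1 ∧
      tateJ q = algebraMap L' (w.adicCompletion L') (C.baseChange L').j ∧ r ^ (2 * ℓ) = q ∧
      Valued.v (algebraMap L' (w.adicCompletion L') (C.baseChange L').j) = ((Valued.v r)⁻¹) ^ (2 * ℓ) :=
  D.exists_pow_two_mul_l_eq_tateParameter w
    (D.hasSplitMultiplicativeReductionAt_baseChange_of_hasMultiplicativeReductionAt w hmult)

/-- The same at a place `w₀ ∈ V^{odd,ss}_{L'}` (Joshi's hypothesis «`w ∈ V^{odd,ss}`» of §3.4.1, p.29 l.11–12),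
in the `FinitePlace` phrasing of E-t6's `exists_root_tateParameter_of_split`, `hsplit` discharged.
[claim: Joshi2024ATS3, status: disputed] [cite: SilvermanATAEC1994, Thm. V.5.3 (PDF pp. 407–409)] -/
theorem exists_pow_two_mul_l_eq_tateParameter_of_mem_voddss (w₀ : FinitePlace L')
    (hw : w₀ ∈ ATS3.Voddss C L') :
    ∃ q r : w₀.maximalIdeal.adicCompletion L', q ≠ 0 ∧ ‖q‖ < 1 ∧
      tateJ q = algebraMap L' _ (C.baseChange L').j ∧ r ^ (2 * ℓ) = q :=
  D.exists_root_tateParameter_of_split w₀ (D.hasSplitMultiplicativeReductionAt_of_mem_voddss w₀ hw)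

/-- **[J-III] §3.4.1, p.29 l.17–19, THE TYPED CLAIM `TateParameterRootTwoL` HOLDS** for Joshi's data (1)–(14)
(with `L L' Lbar : Type`): for `w₀ ∈ V` in `V^{odd,ss}_{L'}` over `v₀ ∈ V^{odd,ss}_L`, any continuous `L`-compatible
`ι : L_{v₀} →+* L'_{w₀}` and `|j(C)|_{v₀} > 1`, the image under `ι` of the Tate parameter
`q_{v₀} = tateParameter (C ⊗ L_{v₀})` is a `2ℓ`-th power in `L'_{w₀}`. Proof: `w₀` is a place of SPLIT
multiplicative reduction of `C ×_L L'` (`hasSplitMultiplicativeReductionAt_of_mem_voddss`, from (12)–(13)), so the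
Tate parameter `q_{w₀} ∈ L'_{w₀}` is `r^{2ℓ}` (E-t6's `exists_root_tateParameter_of_split`, from (10) + (13));
and `ι(q_{v₀}) = q_{w₀}` because `ι(q_{v₀}) ≠ 0`, `‖ι(q_{v₀})‖ < 1` (`TateTransport.norm_map_lt_one`) and
`tateJ (ι q_{v₀}) = ι (tateJ q_{v₀}) = ι(j(C)) = j(C)` (`TateTransport.map_tateJ`, `L`-compatibility of `ι`), by
uniqueness of the Tate parameter (the tree's `eq_of_tateJ_eq`, ATAEC Lemma V.5.1). The binders `Val.non w₀ ∈ V`,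
`v₀ ∈ V^{odd,ss}_L` and `w₀ ∣ v₀` of the printed sentence are idle in the proof.
[claim: Joshi2024ATS3, status: disputed] [cite: SilvermanATAEC1994, Lemma V.5.1 and Thm. V.5.3 (PDF pp. 405–409)] -/
theorem tateParameterRootTwoL_holds : D.TateParameterRootTwoL := by
  intro w₀ v₀ _hV hw _hv _hres ι hι hιL hj
  haveI : (C.map (algebraMap L (v₀.maximalIdeal.adicCompletion L))).IsElliptic := inferInstance
  have hq₀0 := tateParameter_ne_zero (C.map (algebraMap L (v₀.maximalIdeal.adicCompletion L))) hj
  have hq₀n := norm_tateParameter_lt_one (C.map (algebraMap L (v₀.maximalIdeal.adicCompletion L))) hj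
  have hq₀j := tateJ_tateParameter (C.map (algebraMap L (v₀.maximalIdeal.adicCompletion L))) hj
  obtain ⟨q, r, hq0, hqn, hqj, hr⟩ := D.exists_pow_two_mul_l_eq_tateParameter_of_mem_voddss w₀ hw
  have h1 : ‖ι (tateParameter (C.map (algebraMap L (v₀.maximalIdeal.adicCompletion L))) hj)‖ < 1 :=
    TateTransport.norm_map_lt_one ι hι hq₀n
  have h2 : tateJ (ι (tateParameter (C.map (algebraMap L (v₀.maximalIdeal.adicCompletion L))) hj)) =
      algebraMap L' (w₀.maximalIdeal.adicCompletion L') (C.baseChange L').j := by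
    have ej1 : (C.map (algebraMap L (v₀.maximalIdeal.adicCompletion L))).j =
        algebraMap L (v₀.maximalIdeal.adicCompletion L) C.j := C.map_j _
    have ej2 : (C.baseChange L').j = algebraMap L L' C.j := C.map_j _
    rw [← TateTransport.map_tateJ ι hι hq₀n, hq₀j, ej1, hιL, ej2]
  have h3 : ι (tateParameter (C.map (algebraMap L (v₀.maximalIdeal.adicCompletion L))) hj) = q :=
    eq_of_tateJ_eq ((map_ne_zero ι).mpr hq₀0) h1 hq0 hqn (h2.trans hqj.symm)
  exact ⟨r, by rw [hr, h3]⟩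

end Split

end Summit.ABC.IUTFork.Joshi.ATS3.InitialThetaData

end
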